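import Mathlib

/-!
# `OverbindingBudget` / crux `RobustDefectLimitWindows` (stmt-AtomisticToContinuum-31280) — «RunCut»: THE TWO-PLANE LEMMA (crossing exclusion, geometric kernel)

Support file (lens-4 g87, part 12; memo `g87/memo/SW-CHI.md` §9.2 (L5), §10.4, order (2c)).  Two planes whose unit normals make an angle with `|cos| ≤ c < 1` and which both pass
within `d` of a point `x` have a COMMON point within `√(2/(1−c))·d` of `x`; for two distinct `{111}` families (`|cos| = 1/3`) the constant is `√3`.  This is the Euclidean step of the
crossing exclusion: two non-parallel complete h-sheets that both come `d`-close to a site meet (as planes) within `√3·d` of it, where the hexagonal nets of both sheets have sites within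
covering radius — contradicting two-shell exclusivity there.  Pure Mathlib; any real inner-product space.

* `two_plane_point` — ★ the common point `z = x + a•n₁ + b•n₂` (the `2 × 2` Gram system), with `(1 − c)·‖z − x‖² ≤ 2d²`;
* `abs_inner_le_of_dist_le` — «passes within `d`» from a plane point `q` with `dist x q ≤ d`;
* `two_plane_point_sqrt3` — the `{111}` constant: `|⟪n₁,n₂⟫| ≤ 1/3` ⇒ a common point within `√3·d`;
* `cube_diagonal_cos_sq` (`decide`) — distinct body diagonals `(±1,±1,±1)` have `9·(u·v)² = (u·u)(v·v)`, i.e. `|cos| = 1/3`.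
[this file: 0 definitions, 4 theorems; imports Mathlib only; standard axioms]
-/

namespace Summit.AtomisticToContinuum.Crystallization.Theorems.OverbindingBudgetAffineRunCutTwoPlane

open scoped InnerProductSpace

variable {V : Type*} [NormedAddCommGroup V] [InnerProductSpace ℝ V]

/-- ★ **TWO-PLANE LEMMA.**  Unit normals `n₁`, `n₂` with `|⟪n₁,n₂⟫| ≤ c < 1`; the planes `{z | ⟪n₁, z − p₁⟫ = 0}` and `{z | ⟪n₂, z − p₂⟫ = 0}` pass within `d` of `x`
(`|⟪nᵢ, x − pᵢ⟫| ≤ d`).  Then some point `z` lies on both planes with `(1 − c)·‖z − x‖² ≤ 2·d²`. [this file · kind: proof] -/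
theorem two_plane_point {n₁ n₂ x p₁ p₂ : V} {c d : ℝ} (h₁ : ‖n₁‖ = 1) (h₂ : ‖n₂‖ = 1) (hc : |⟪n₁, n₂⟫_ℝ| ≤ c) (hc1 : c < 1)
    (hd₁ : |⟪n₁, x - p₁⟫_ℝ| ≤ d) (hd₂ : |⟪n₂, x - p₂⟫_ℝ| ≤ d) :
    ∃ z : V, ⟪n₁, z - p₁⟫_ℝ = 0 ∧ ⟪n₂, z - p₂⟫_ℝ = 0 ∧ (1 - c) * ‖z - x‖ ^ 2 ≤ 2 * d ^ 2 := by
  set g : ℝ := ⟪n₁, n₂⟫_ℝ with hg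
  set δ₁ : ℝ := ⟪n₁, x - p₁⟫_ℝ with hδ₁
  set δ₂ : ℝ := ⟪n₂, x - p₂⟫_ℝ with hδ₂
  have hg1 : |g| < 1 := lt_of_le_of_lt hc hc1
  have hga : |g| ^ 2 = g ^ 2 := sq_abs g
  have hD : 0 < 1 - g ^ 2 := by nlinarith [abs_nonneg g]
  have hDne : 1 - g ^ 2 ≠ 0 := hD.ne'
  set a : ℝ := (g * δ₂ - δ₁) / (1 - g ^ 2) with ha
  set b : ℝ := (g * δ₁ - δ₂) / (1 - g ^ 2) with hb
  have hn11 : ⟪n₁, n₁⟫_ℝ = 1 := by rw [real_inner_self_eq_norm_sq, h₁]; norm_num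
  have hn22 : ⟪n₂, n₂⟫_ℝ = 1 := by rw [real_inner_self_eq_norm_sq, h₂]; norm_num
  have hn21 : ⟪n₂, n₁⟫_ℝ = g := by rw [hg, real_inner_comm]
  -- the Gram system: a + g b = -δ₁, g a + b = -δ₂
  have hsys₁ : a + g * b = -δ₁ := by
    rw [ha, hb]; field_simp; ring
  have hsys₂ : g * a + b = -δ₂ := by
    rw [ha, hb]; field_simp; ring
  refine ⟨x + a • n₁ + b • n₂, ?_, ?_, ?_⟩
  · have hz : x + a • n₁ + b • n₂ - p₁ = (x - p₁) + a • n₁ + b • n₂ := by abel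
    rw [hz, inner_add_right, inner_add_right, inner_smul_right, inner_smul_right, hn11, ← hg, ← hδ₁]
    linear_combination hsys₁
  · have hz : x + a • n₁ + b • n₂ - p₂ = (x - p₂) + a • n₁ + b • n₂ := by abel
    rw [hz, inner_add_right, inner_add_right, inner_smul_right, inner_smul_right, hn21, hn22, ← hδ₂]
    linear_combination hsys₂
  · have hz : x + a • n₁ + b • n₂ - x = a • n₁ + b • n₂ := by abel
    have hsq : ‖a • n₁ + b • n₂‖ ^ 2 = a ^ 2 + b ^ 2 + 2 * a * b * g := by
      rw [← real_inner_self_eq_norm_sq]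
      simp only [inner_add_left, inner_add_right, real_inner_smul_left, real_inner_smul_right, hn11, hn22, hn21, ← hg]
      ring
    -- the key identity: (1 - g²)(a² + b² + 2abg) = δ₁² + δ₂² - 2 g δ₁ δ₂
    have hkey : (1 - g ^ 2) * (a ^ 2 + b ^ 2 + 2 * a * b * g) = δ₁ ^ 2 + δ₂ ^ 2 - 2 * g * δ₁ * δ₂ := by
      rw [ha, hb]; field_simp; ring
    have hd0 : 0 ≤ d := (abs_nonneg _).trans hd₁
    have hδ₁' : δ₁ ^ 2 ≤ d ^ 2 := by
      rw [← sq_abs δ₁]; exact pow_le_pow_left₀ (abs_nonneg _) hd₁ 2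
    have hδ₂' : δ₂ ^ 2 ≤ d ^ 2 := by
      rw [← sq_abs δ₂]; exact pow_le_pow_left₀ (abs_nonneg _) hd₂ 2
    have hcross : -(2 * g * δ₁ * δ₂) ≤ 2 * |g| * d ^ 2 := by
      have h1 : -(2 * g * δ₁ * δ₂) ≤ |2 * g * δ₁ * δ₂| := neg_le_abs _
      have h2 : |2 * g * δ₁ * δ₂| = 2 * |g| * (|δ₁| * |δ₂|) := by
        rw [abs_mul, abs_mul, abs_mul, abs_two]; ring
      have h3 : |δ₁| * |δ₂| ≤ d * d := mul_le_mul hd₁ hd₂ (abs_nonneg _) hd0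
      nlinarith [abs_nonneg g]
    have hN : δ₁ ^ 2 + δ₂ ^ 2 - 2 * g * δ₁ * δ₂ ≤ 2 * d ^ 2 * (1 + |g|) := by nlinarith
    have hN0 : 0 ≤ a ^ 2 + b ^ 2 + 2 * a * b * g := by
      rw [← hsq]; positivity
    rw [hz, hsq]
    -- (1 - c) S ≤ (1 - |g|) S and (1 - g²) S ≤ 2 d² (1 + |g|) ⇒ (1 - |g|) S ≤ 2 d²
    have hcg : 1 - c ≤ 1 - |g| := by linarith
    have hstep : (1 - |g|) * (a ^ 2 + b ^ 2 + 2 * a * b * g) ≤ 2 * d ^ 2 := by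
      have hpos : 0 < 1 + |g| := by positivity
      have h' : (1 + |g|) * ((1 - |g|) * (a ^ 2 + b ^ 2 + 2 * a * b * g)) ≤ (1 + |g|) * (2 * d ^ 2) := by
        have : (1 + |g|) * ((1 - |g|) * (a ^ 2 + b ^ 2 + 2 * a * b * g)) = (1 - g ^ 2) * (a ^ 2 + b ^ 2 + 2 * a * b * g) := by
          rw [← hga]; ring
        rw [this, hkey]; linarith
      exact le_of_mul_le_mul_left h' hpos
    calc (1 - c) * (a ^ 2 + b ^ 2 + 2 * a * b * g) ≤ (1 - |g|) * (a ^ 2 + b ^ 2 + 2 * a * b * g) := mul_le_mul_of_nonneg_right hcg hN0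
      _ ≤ 2 * d ^ 2 := hstep

/-- «The plane passes within `d` of `x`» from a plane point: if `⟪n, q − p⟫ = 0`, `‖n‖ = 1` and `dist x q ≤ d` then `|⟪n, x − p⟫| ≤ d`. [this file · kind: glue] -/
theorem abs_inner_le_of_dist_le {n x p q : V} {d : ℝ} (hn : ‖n‖ = 1) (hq : ⟪n, q - p⟫_ℝ = 0) (hxq : dist x q ≤ d) : |⟪n, x - p⟫_ℝ| ≤ d := by
  have h : x - p = (x - q) + (q - p) := by abel
  rw [h, inner_add_right, hq, add_zero]
  calc |⟪n, x - q⟫_ℝ| ≤ ‖n‖ * ‖x - q‖ := abs_real_inner_le_norm _ _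
    _ = dist x q := by rw [hn, one_mul, dist_eq_norm]
    _ ≤ d := hxq

/-- ★ **THE `{111}` CONSTANT.**  `|⟪n₁,n₂⟫| ≤ 1/3` (two distinct close-packed families of a cubic site) and both planes within `d` of `x` ⇒ a common point within `√3·d` of `x`.
[this file · kind: proof] -/
theorem two_plane_point_sqrt3 {n₁ n₂ x p₁ p₂ : V} {d : ℝ} (h₁ : ‖n₁‖ = 1) (h₂ : ‖n₂‖ = 1) (hc : |⟪n₁, n₂⟫_ℝ| ≤ 1 / 3)
    (hd₁ : |⟪n₁, x - p₁⟫_ℝ| ≤ d) (hd₂ : |⟪n₂, x - p₂⟫_ℝ| ≤ d) :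
    ∃ z : V, ⟪n₁, z - p₁⟫_ℝ = 0 ∧ ⟪n₂, z - p₂⟫_ℝ = 0 ∧ dist z x ≤ Real.sqrt 3 * d := by
  obtain ⟨z, hz₁, hz₂, hzx⟩ := two_plane_point h₁ h₂ hc (by norm_num) hd₁ hd₂
  refine ⟨z, hz₁, hz₂, ?_⟩
  have hd0 : 0 ≤ d := (abs_nonneg _).trans hd₁
  have hsq : ‖z - x‖ ^ 2 ≤ (Real.sqrt 3 * d) ^ 2 := by
    rw [mul_pow, Real.sq_sqrt (by norm_num : (0:ℝ) ≤ 3)]; linarith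
  rw [dist_eq_norm]
  exact (abs_le_of_sq_le_sq' hsq (by positivity)).2

/-- The four body diagonals `(1,1,1), (1,1,−1), (1,−1,1), (−1,1,1)` (the `{111}` normals of a cubic site, up to sign): any two distinct ones satisfy `9·(u·v)² = (u·u)·(v·v)`,
i.e. `|cos ∠| = 1/3`. [this file · kind: computation] -/
theorem cube_diagonal_cos_sq : ∀ u ∈ [((1 : ℤ), (1 : ℤ), (1 : ℤ)), (1, 1, -1), (1, -1, 1), (-1, 1, 1)], ∀ v ∈ [((1 : ℤ), (1 : ℤ), (1 : ℤ)), (1, 1, -1), (1, -1, 1), (-1, 1, 1)],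
    u ≠ v → 9 * (u.1 * v.1 + u.2.1 * v.2.1 + u.2.2 * v.2.2) ^ 2 = (u.1 * u.1 + u.2.1 * u.2.1 + u.2.2 * u.2.2) * (v.1 * v.1 + v.2.1 * v.2.1 + v.2.2 * v.2.2) := by
  decide

end Summit.AtomisticToContinuum.Crystallization.Theorems.OverbindingBudgetAffineRunCutTwoPlane
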